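import Literature.Analysis.FluidPDE.BradshawTsaiDSSExistenceHolds
import Literature.Analysis.FluidPDE.ForwardDSSExistenceLocalProofs
import HarnessLib

/-!
# Discharges of named facts of `ForwardDSSExistenceLocal.lean`

`Literature/Analysis/FluidPDE/ForwardDSSExistenceLocalHolds.lean` — proofs-only sibling of
`ForwardDSSExistenceLocal.lean` (no definitions, no named facts). Each theorem below closes a
named fact `X : Prop` of that file as `X_holds : X` by composing an ACCEPTED reduction theorem
of the tree with the ACCEPTED unconditional `_holds` discharges of all of its hypotheses;
nothing is re-proved and no statement is changed. Recorded by the librarian sweep g25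
(2026-08-16, pass 5c: facts dischargeable in one line from the tree's own lemmas), so that the
facts census, `#h21_route_deps` and the cone guardrail see these facts as theorems.

Discharged here:

* `bradshawTsai2019_prop_3_1_dss_holds` := `bradshawTsai2019_prop_3_1_dss_of_prop_3_1`
  `bradshawTsai2019_prop_3_1_holds` (`ForwardDSSExistenceLocalProofs.lean`).

## References

* [BradshawTsai2019] — see `lean/references.bib` and the docstring of the fact in `ForwardDSSExistenceLocal.lean`.
-/

namespace Literature.Analysis.FluidPDE

/-- **Discharge of the named fact `bradshawTsai2019_prop_3_1_dss`**
(`ForwardDSSExistenceLocal.lean`): Bradshaw–Tsai 2019, Proposition 3.1, with the DSS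
invariance of the pressure (arXiv:1801.08060, p. 8; the accepted rendering
`bradshawTsai2019_prop_3_1`, quoted there verbatim, plus one clause). Prop. … — obtained as
`bradshawTsai2019_prop_3_1_dss_of_prop_3_1` applied to the tree's unconditional discharge
`bradshawTsai2019_prop_3_1_holds` of its hypothesis (reduction in
`ForwardDSSExistenceLocalProofs.lean`).
[cite: BradshawTsai2019, Prop 3.1 with (3.3)] -/
theorem bradshawTsai2019_prop_3_1_dss_holds :
    bradshawTsai2019_prop_3_1_dss :=
  bradshawTsai2019_prop_3_1_dss_of_prop_3_1 bradshawTsai2019_prop_3_1_holds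

end Literature.Analysis.FluidPDE
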